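import Summits.CriticalPhenomena.PercolationContinuityZ3.Theorems.PercNearOneGluingNoHeavyQuantCatHullCertChkR8Struct
import Summits.CriticalPhenomena.PercolationContinuityZ3.Theorems.PercNearOneGluingNoHeavyQuantCatHullCertChkR8Leaf1
import Summits.CriticalPhenomena.PercolationContinuityZ3.Theorems.PercNearOneGluingNoHeavyQuantCatHullCertChkR8Leaf2
import Summits.CriticalPhenomena.PercolationContinuityZ3.Theorems.PercNearOneGluingNoHeavyQuantCatHullCertChkR8Leaf3
import Summits.CriticalPhenomena.PercolationContinuityZ3.Theorems.PercNearOneGluingNoHeavyQuantCatHullCertChkR8Leaf4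
import Summits.CriticalPhenomena.PercolationContinuityZ3.Theorems.PercNearOneGluingNoHeavyQuantCatHullCertChkR8Leaf5
import Summits.CriticalPhenomena.PercolationContinuityZ3.Theorems.PercNearOneGluingNoHeavyQuantCatHullCertChkR8Leaf6
import Summits.CriticalPhenomena.PercolationContinuityZ3.Theorems.PercNearOneGluingNoHeavyQuantCatHullCertChkR8Leaf59
import Summits.CriticalPhenomena.PercolationContinuityZ3.Theorems.PercNearOneGluingNoHeavyQuantCatHullCertChkR8Leaf60
import Summits.CriticalPhenomena.PercolationContinuityZ3.Theorems.PercNearOneGluingNoHeavyQuantCatHullCertChkR8Leaf61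
import Summits.CriticalPhenomena.PercolationContinuityZ3.Theorems.PercNearOneGluingNoHeavyQuantCatHullCertChkR8Leaf62
import Summits.CriticalPhenomena.PercolationContinuityZ3.Theorems.PercNearOneGluingNoHeavyQuantCatHullCertChkR8Leaf63
import HarnessLib

/-!
# QUANT lane R8, T-DEC: **THE LIGHT CORNER `lpT 4 (17/25) (499/680)` IS OUTSIDE THE GATED CATEGORY HULL AT FLOOR 997/2000** — kernel theorems
# `¬ TreeBuiltCatHullLight`, `¬ CatPairLight`

builds on p205010 (kernel theorem, internal audit signed; external expert review pending)

Computational support file (`--supports stmt-CriticalPhenomena-4575`), census seat prim-quant-census-2 (gen 78): assembles the kernel evaluations of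
`CertData.check2` for `certDataR8` (shards `…ChkR8Struct`, `…ChkR8Leaf*`) with the soundness theorems of `…QuantCatHullCertificate2`:
**`lpT_corner997_out`**, **`not_treeBuiltCatHullLight`**, **`not_catPairLight`** — the two census-2 predictions (T) and (P) of the QUANT lane's law-decoupling
programme are FALSE: the offset value certificate separates the product law from the hull.  [this work].  Nothing here is cited as a published result.  The gluing rows served [cite: KozmaNitzan2024, Conjecture 3 (p. 15)]; product measure [cite: Grimmett1999, §1.3 p. 10].
-/

noncomputable section

namespace Summit.CriticalPhenomena.PercolationContinuityZ3.Theorems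
namespace Quant
namespace LawDec
open Tab

/-- all leaf checks pass (from the shards). [this work] -/
theorem certDataR8_leafChecks : certDataR8.leafChecks = true := by
  simp only [CertData.leafChecks, CertData.leafList, List.all_cons, List.all_nil, Bool.and_true, Bool.and_eq_true]
  refine ⟨?_, ?_, ?_, ?_, ?_, ?_, ?_, ?_, ?_, ?_, ?_, ?_, ?_, ?_, ?_, ?_, ?_, ?_, ?_, ?_, ?_, ?_, ?_, ?_, ?_, ?_, ?_, ?_, ?_, ?_⟩ <;> simp only [certR8Leaf_0_10_zero, certR8Leaf_0_1_seg, certR8Leaf_0_1_tri, certR8Leaf_0_1_zero, certR8Leaf_0_2_zero, certR8Leaf_0_3_zero, certR8Leaf_0_4_seg, certR8Leaf_0_4_tri, certR8Leaf_0_4_zero, certR8Leaf_0_5_seg, certR8Leaf_0_5_tri, certR8Leaf_0_5_zero, certR8Leaf_0_6_zero, certR8Leaf_0_8_zero, certR8Leaf_0_9_zero, certR8Leaf_1_1_seg, certR8Leaf_1_1_zero, certR8Leaf_1_3_zero, certR8Leaf_1_4_seg, certR8Leaf_1_4_tri, certR8Leaf_1_4_zero, certR8Leaf_1_5_seg, certR8Leaf_1_5_zero,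 certR8Leaf_1_8_zero, certR8Leaf_1_9_zero, certR8Leaf_2_1_zero, certR8Leaf_2_3_zero, certR8Leaf_2_4_seg, certR8Leaf_2_4_zero, certR8Leaf_2_5_zero, certR8Leaf_2_8_zero, certR8Leaf_3_1_zero, certR8Leaf_3_4_zero, certR8Leaf_3_5_zero, certR8Leaf_4_1_zero, certR8Leaf_4_4_zero, certR8Leaf_4_5_zero, certR8Leaf_5_1_zero, certR8Leaf_5_4_zero, certR8Leaf_5_5_zero, certR8Leaf_6_4_zero, Bool.and_self, if_true, Nat.reduceAdd] <;> decide

/-- **the complete check passes.** [this work] -/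
theorem certDataR8_check2 : certDataR8.check2 = true := by
  simp only [CertData.check2, certDataR8_structChecks2, certDataR8_leafChecks, certDataR8_finalOK2, Bool.and_self]

/-- **THE LIGHT CORNER IS OUTSIDE THE HULL**: `lpT 4 (17/25) (499/680) ∉ InGatedCatHull (997/2000) (669/125) 10`. [this work] -/
theorem lpT_corner997_out : ¬ InGatedCatHull (997 / 2000 : ℝ) (669 / 125) 10 (lpT 4 (17 / 25) (499 / 680)) := CertData.not_mem2 certDataR8 certDataR8_check2

/-- **PREDICTION (T) IS FALSE.** [this work] -/
theorem not_treeBuiltCatHullLight : ¬ TreeBuiltCatHullLight := CertData.not_treeBuiltCatHullLight2 certDataR8 certDataR8_check2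

/-- **PREDICTION (P) IS FALSE.** [this work] -/
theorem not_catPairLight : ¬ CatPairLight := CertData.not_catPairLight2 certDataR8 certDataR8_check2

end LawDec
end Quant
end Summit.CriticalPhenomena.PercolationContinuityZ3.Theorems
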